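import Summits.QuantumFields.GaugeBoot.TiltedBoxEvenMidAxisRPTwoDim
import HarnessLib

/-!
# Two-dimensional link-mirror RP of the even box: the Gram blocks and the literal `d = 2` instance (gauge-boot, L3 supplement)

HONEST FRAMING (cell `pub-gaugeboot`, page 1 of every file): the venture produces certified bounds
on lattice expectations at stated coupling, gauge group, dimension and torus size; NOT a mass gap,
NOT a continuum limit, NOT a string tension; NOT Yang–Mills-summit-bearing (barriers
`FixedCouplingUltralocality`, `PerturbativeInvisibility`). Corollaries of the structural positive
result `tiltedBox_midAxisRP_twoDim` (`TiltedBoxEvenMidAxisRPTwoDim.lean`, the LINK mirror `x_i ↦ 1 - x_i`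
of the even box `Γ(2P, 2P)`, `P ≥ 2`); no expectation of the venture's tables is bounded here.

* `tiltedBox_midAxisRP_twoDim_blocks` — the reflection-positivity BLOCKS
  `(∫ conj(F_a ∘ Θ_mid) F_b dμ_β)_{a,b}` of bounded measurable observables of `{1 ≤ x_i ≤ P}` are positive
  semidefinite (a constraint block for a two-dimensional loop-equation SDP on the tilted box `Γ(2P, 2P)`,
  every real `β`);
* `tiltedBox_midAxisRP_fin_two` — the statement on `ℤ²/Γ(2P, 2P)` literally (`d = 2`, `i = 0`, `j = 1`).

References: K. Osterwalder, E. Seiler, Ann. Phys. 110 (1978) 440, §2; V. Kazakov, Z. Zheng,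
arXiv:2203.11360 §3.1 (reflection-positivity blocks of the lattice bootstrap).
-/

noncomputable section

open MeasureTheory Complex
open scoped ComplexOrder ComplexConjugate

namespace Summit.QuantumFields.GaugeBoot

namespace TiltedRP

namespace TwoDim

variable {d : ℕ} {i j : Fin d} {L P N : ℕ} [NeZero L] [NeZero P]
variable {G : Type*} [Group G] [TopologicalSpace G] [IsTopologicalGroup G] [CompactSpace G]
  [MeasurableSpace G] [BorelSpace G] [SecondCountableTopology G]
variable (ρ : G →* Matrix (Fin N) (Fin N) ℂ)

/-- **The two-dimensional link-mirror RP blocks are positive semidefinite**: for bounded measurable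
observables `F_1, …, F_n` of `{1 ≤ x_i ≤ P}` and `c ∈ ℂ^n`,
`0 ≤ ∑_{a,b} conj c_a · c_b · ∫ conj(F_a(Θ_mid U)) F_b(U) dμ_β` (every real `β`, `P ≥ 2`). -/
theorem tiltedBox_midAxisRP_twoDim_blocks (hP : 2 ≤ P) (hij : i ≠ j) (hd : ∀ k : Fin d, k = i ∨ k = j)
    (hρ : Continuous ρ) (β : ℝ) {n : ℕ}
    (F : Fin n → Config (TiltedSite d i j (2 * P) (2 * P) L) d G → ℂ) (hFm : ∀ a, Measurable (F a))
    (hFb : ∀ a, ∃ C : ℝ, ∀ U, ‖F a U‖ ≤ C)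
    (hFo : ∀ a, IsMidObservable (tiltedUnit d i j (2 * P) (2 * P) L) P (axisCoord d L (2 * P)) (F a)) (c : Fin n → ℂ) :
    0 ≤ ∑ a, ∑ b, conj (c a) * c b *
      ∫ U, conj (F a (configMidReflect (tiltedUnit d i j (2 * P) (2 * P) L) i
        (tiltedAxisFlip d L (2 * P) hij) U)) * F b U ∂(gibbs ρ (tiltedUnit d i j (2 * P) (2 * P) L) β) := by
  haveI := isProbabilityMeasure_gibbs (A := TiltedSite d i j (2 * P) (2 * P) L) (G := G) ρ hρ
    (tiltedUnit d i j (2 * P) (2 * P) L) β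
  have hΘm : Measurable (configMidReflect (G := G) (tiltedUnit d i j (2 * P) (2 * P) L) i
      (tiltedAxisFlip d L (2 * P) hij)) := (measurePreserving_configMidReflect_flip (L := L) (P := P) (G := G) hij).measurable
  -- the combination `H = ∑_b c_b F_b`
  set H : Config (TiltedSite d i j (2 * P) (2 * P) L) d G → ℂ := fun U => ∑ b, c b * F b U with hH
  have hHm : Measurable H := Finset.measurable_sum _ fun b _ => (hFm b).const_mul _
  choose C hC using hFb
  have hHb : ∃ K : ℝ, ∀ U, ‖H U‖ ≤ K := ⟨∑ b, ‖c b‖ * C b, fun U =>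
    (norm_sum_le _ _).trans (Finset.sum_le_sum fun b _ => by
      rw [norm_mul]; exact mul_le_mul_of_nonneg_left (hC b U) (norm_nonneg _))⟩
  have hHo : IsMidObservable (tiltedUnit d i j (2 * P) (2 * P) L) P (axisCoord d L (2 * P)) H := fun U V hUV => by
    simp only [hH]
    exact Finset.sum_congr rfl fun b _ => by rw [hFo b U V hUV]
  have key := tiltedBox_midAxisRP_twoDim ρ hP hij hd hρ β H hHm hHb hHo
  have hint : ∀ a b, Integrable (fun U => conj (F a (configMidReflect (tiltedUnit d i j (2 * P) (2 * P) L) i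
      (tiltedAxisFlip d L (2 * P) hij) U)) * F b U) (gibbs ρ (tiltedUnit d i j (2 * P) (2 * P) L) β) :=
    fun a b => Integrable.of_bound
      (((Complex.continuous_conj.measurable.comp ((hFm a).comp hΘm)).mul (hFm b)).aestronglyMeasurable) (C a * C b)
      (ae_of_all _ fun U => by
        rw [norm_mul, Complex.norm_conj]
        exact mul_le_mul (hC a _) (hC b U) (norm_nonneg _) ((norm_nonneg (F a U)).trans (hC a U)))
  have hexp : ∫ U, conj (H (configMidReflect (tiltedUnit d i j (2 * P) (2 * P) L) i
      (tiltedAxisFlip d L (2 * P) hij) U)) * H U ∂(gibbs ρ (tiltedUnit d i j (2 * P) (2 * P) L) β) =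
      ∑ a, ∑ b, conj (c a) * c b * ∫ U, conj (F a (configMidReflect (tiltedUnit d i j (2 * P) (2 * P) L) i
        (tiltedAxisFlip d L (2 * P) hij) U)) * F b U ∂(gibbs ρ (tiltedUnit d i j (2 * P) (2 * P) L) β) := by
    have h1 : ∀ U, conj (H (configMidReflect (tiltedUnit d i j (2 * P) (2 * P) L) i
        (tiltedAxisFlip d L (2 * P) hij) U)) * H U =
        ∑ a, ∑ b, conj (c a) * c b * (conj (F a (configMidReflect (tiltedUnit d i j (2 * P) (2 * P) L) i
          (tiltedAxisFlip d L (2 * P) hij) U)) * F b U) := fun U => by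
      simp only [hH, map_sum, map_mul]
      rw [Finset.sum_mul_sum]
      exact Finset.sum_congr rfl fun a _ => Finset.sum_congr rfl fun b _ => by ring
    simp_rw [h1]
    rw [integral_finsetSum _ fun a _ => integrable_finsetSum _ fun b _ => (hint a b).const_mul _]
    refine Finset.sum_congr rfl fun a _ => ?_
    rw [integral_finsetSum _ fun b _ => (hint a b).const_mul _]
    exact Finset.sum_congr rfl fun b _ => integral_const_mul _ _
  rwa [hexp] at key

/-- **The two-dimensional statement, literally**: on `ℤ²/Γ(2P, 2P)` (`d = 2`, link mirror of the
coordinate `x_0 ↦ 1 - x_0`, mirror partner `x_1`), `P ≥ 2`, every compact second countable `G`, every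
continuous `ρ`, every real `β`: the hybrid link mirror is reflection positive for the closed half
`{1 ≤ x_0 ≤ P}`. -/
theorem tiltedBox_midAxisRP_fin_two (hP : 2 ≤ P) (hρ : Continuous ρ) (β : ℝ)
    (F : Config (TiltedSite 2 0 1 (2 * P) (2 * P) L) 2 G → ℂ) (hFm : Measurable F)
    (hFb : ∃ C : ℝ, ∀ U, ‖F U‖ ≤ C)
    (hFo : IsMidObservable (tiltedUnit 2 0 1 (2 * P) (2 * P) L) P (axisCoord 2 L (2 * P)) F) :
    0 ≤ ∫ U, conj (F (configMidReflect (tiltedUnit 2 0 1 (2 * P) (2 * P) L) 0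
        (tiltedAxisFlip 2 L (2 * P) Fin.zero_ne_one) U)) * F U
      ∂(gibbs ρ (tiltedUnit 2 0 1 (2 * P) (2 * P) L) β) :=
  tiltedBox_midAxisRP_twoDim ρ hP Fin.zero_ne_one (fun k => by fin_cases k <;> simp) hρ β F hFm hFb hFo

end TwoDim

end TiltedRP

end Summit.QuantumFields.GaugeBoot

end
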